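import Mathlib
import Literature.NumberTheory.LFunctions.Zhang2022.Section6TailBounds
import Literature.NumberTheory.Sieve.LargeSieveCharacters
import HarnessLib

/-!
# Zhang (2022), §6, proof of Lemma 6.1: `Z(s+w,ψ)P₄^w ≪ (2T²)^{−u}` on the (6.2) contour
# (DAG `Z22:§6.u013`), kernel-checked

Topic `Literature/NumberTheory/LFunctions/Zhang2022` (Landau–Siegel audit tree; verdict-neutral).
Y. Zhang, *Discrete mean estimates and the Landau–Siegel zero*, arXiv:2211.02515v1 (2022)
[Zhang2022LandauSiegel] — **an unrefereed manuscript under adjudication; nothing here asserts or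
denies its Theorems 1–2.** Campaign D-0069 (discharge lane, layer L2): companion of
`Section6TailBounds.lean`; THEOREM-ONLY.

§6 p. 32 (tex L1746–1750), inside the proof of (6.2):

> in the case `−𝓛⁹ ≤ u ≤ −1`, `|v| ≤ 𝓛²⁰`, by (4.) we have `Z(s+w,ψ)P₄^w ≪ (2T²)^{−u}`

(the reference "(4.)" is dangling in the source; this file supplies a derivation). The typed claim is
`Section6Statements.Step6u013` (with the blanket Assumption (A) binder, unused here).

| decl | DAG node | status |
|---|---|---|
| `norm_Zfac_le` | — | `‖Z(σ+it,θ)‖ ≤ 4(kt/2π)^{1/2−σ}` for primitive `θ (mod k)`, `|σ| ≤ A`, `t ≥ max(1, 38(A+1)²)` — (2.4) exact (`GammaFactor.Zfac_eq`, `|r| ≤ 3e^{−πt}`), `|τ(θ)| = √k` (`Sieve.LargeSieve.norm_gaussSum_sq`), Stirling in a growing strip (`rsChi_stirling_of_abs_le`, Titchmarsh (4.12.3)) |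
| `im_add_range`, `abs_re_add_le`, `stirling_threshold_le`, `p_range`, `log_two_bigP_t0_le` | — | the ranges `𝓛⁵¹⁹ ≤ t+v ≤ 11𝓛⁵¹⁹`, `|σ+u| ≤ 𝓛⁹`, `38(𝓛⁹+1)² ≤ 𝓛⁵¹⁹`, `P < p ≤ 9P/8`, `log(2Pt₀) ≤ 4𝓛⁹` (`D ≥ 9`) |
| `step6u013_holds` | `§6.u013` | **DISCHARGED**: `Section6Statements.Step6u013` holds, `C = 4e^{8π}`, `D ≥ 9` |

Route: `‖Z(σ′+it′,ψ)‖ ≤ 4(pt′/2π)^{1/2−σ′}` with `σ′ = σ+u`, `t′ = t+v`, `A = 𝓛⁹`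
(`t′ ≥ 𝓛⁵¹⁹ ≥ 38(A+1)²`), `|P₄^w| = P₄^u`, so the product is `4(pt′/2π)^{1/2−σ}·((pt′/2π)/P₄)^{−u}`
with `(pt′/2π)/P₄ = pt′T²/(2πPt₀) ≤ 2T²` (`p ≤ 9P/8`, `t′ ≤ 11t₀`, `99/8 ≤ 4π`) and
`(pt′/2π)^{1/2−σ} ≤ (2Pt₀)^{2α} ≤ e^{8π}` (`log(2Pt₀) ≤ 4𝓛⁹`, `α = π/𝓛⁹`). No fact beyond the tree's
Stirling/Gauss-sum theorems (FACT-LIST F-07, F-09) is used.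

## References

* Y. Zhang, arXiv:2211.02515v1 (2022), §6 p. 32, proof of Lemma 6.1, (6.2); §2 (2.4), (2.6), (2.8),
  (2.10). [cite: Zhang2022LandauSiegel, §6 (6.2) p.32]
* E. C. Titchmarsh, *The Theory of the Riemann Zeta-Function*, 2nd ed. (1986), §4.12 (4.12.3).
  [cite: Titchmarsh1986, §4.12 (4.12.3)]
-/

noncomputable section

open Complex Real MeasureTheory Set Filter

namespace Literature.NumberTheory.LFunctions.Zhang2022.Section6TailBounds

open Skeleton Section6Statements

/-! ## `Z22:§6.u013`: `Z(s+w,ψ)P₄^w ≪ (2T²)^{−u}` — the size of `Z(s,θ)` by Stirling -/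

/-- **The order of `Z(s,θ)` in a growing strip** (the input behind the dangling "(4.)" of §6
p. 32): for a primitive `θ (mod k)`, `A ≥ 1`, `s = σ + it` with `|σ| ≤ A` and
`t ≥ max(1, 38(A+1)²)`: `‖Z(s,θ)‖ ≤ 4·(kt/2π)^{1/2−σ}` — from the exact form (2.4)
`Z = θ(−1)τ(θ)k^{−s}ϑ(s)(1+r)` (`GammaFactor.Zfac_eq`, `|r| ≤ 3e^{−πt}`), `|τ(θ)| = √k` and the
tree's Stirling formula `|ϑ(σ+it)| = (t/2π)^{1/2−σ}(1+O_A(1/t))` (`rsChi_stirling_of_abs_le`).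
[cite: Zhang2022LandauSiegel, §2 (2.4) p.5] -/
theorem norm_Zfac_le {k : ℕ} [NeZero k] {θ : DirichletCharacter ℂ k} (hθ : θ.IsPrimitive)
    {A : ℝ} (hA : 1 ≤ A) {s : ℂ} (hσ : |s.re| ≤ A) (ht1 : 1 ≤ s.im)
    (htA : 38 * (A + 1) ^ 2 ≤ s.im) :
    ‖GammaFactor.Zfac θ s‖ ≤ 4 * ((k : ℝ) * s.im / (2 * π)) ^ (1 / 2 - s.re) := by
  have hk0 : (0 : ℝ) < k := by exact_mod_cast Nat.pos_of_ne_zero (NeZero.ne k)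
  have ht0 : 0 < s.im := by linarith
  have him : s.im ≠ 0 := ht0.ne'
  -- (2.4) exactly
  rw [GammaFactor.Zfac_eq θ ht0, GammaFactor.vartheta_eq_rsChi him]
  -- Stirling for `ϑ = χ`
  obtain ⟨η, hη, hchi⟩ := rsChi_stirling_of_abs_le hA hσ htA
  have hs : (s.re : ℂ) + (s.im : ℂ) * I = s := Complex.re_add_im s
  rw [hs] at hchi
  have hη1 : ‖η‖ ≤ 1 := by
    refine hη.trans ?_
    rw [div_le_one ht0]
    exact htA
  have hbase : 0 ≤ s.im / (2 * π) := by positivity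
  have hR : 0 ≤ (s.im / (2 * π)) ^ (1 / 2 - s.re) := Real.rpow_nonneg hbase _
  have hchi_norm : ‖SiegelIntegral.rsChi s‖ ≤ 2 * (s.im / (2 * π)) ^ (1 / 2 - s.re) := by
    rw [hchi, norm_mul, norm_mul, Complex.norm_real, Real.norm_of_nonneg hR]
    have hph : ‖cexp ((π / 4 + s.im - s.im * Real.log (s.im / (2 * π))) * I)‖ = 1 := by
      have := Complex.norm_exp_ofReal_mul_I (π / 4 + s.im - s.im * Real.log (s.im / (2 * π)))
      push_cast at this
      exact this
    rw [hph, mul_one]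
    have h1η : ‖1 + η‖ ≤ 2 := by
      calc ‖1 + η‖ ≤ ‖(1 : ℂ)‖ + ‖η‖ := norm_add_le _ _
        _ ≤ 1 + 1 := by rw [norm_one]; exact add_le_add le_rfl hη1
        _ = 2 := by norm_num
    calc (s.im / (2 * π)) ^ (1 / 2 - s.re) * ‖1 + η‖
        ≤ (s.im / (2 * π)) ^ (1 / 2 - s.re) * 2 := mul_le_mul_of_nonneg_left h1η hR
      _ = 2 * (s.im / (2 * π)) ^ (1 / 2 - s.re) := by ring
  -- the other factors
  have hθ1 : ‖θ (-1)‖ ≤ 1 := DirichletCharacter.norm_le_one θ (-1)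
  have hτ : ‖GammaFactor.tau θ‖ = Real.sqrt k := by
    have h := Sieve.LargeSieve.norm_gaussSum_sq hθ
    rw [← Real.sqrt_sq (norm_nonneg (gaussSum θ (ZMod.stdAddChar (N := k)))), h]
  have hkpow : ‖(k : ℂ) ^ (-s)‖ = (k : ℝ) ^ (-s.re) := by
    rw [Complex.norm_natCast_cpow_of_pos (Nat.pos_of_ne_zero (NeZero.ne k))]
    simp
  have hcorr : ‖1 + GammaFactor.corr θ s‖ ≤ 2 := by
    have hc := GammaFactor.norm_corr_le θ ht1
    have he := GammaFactor.exp_neg_pi_mul_le ht1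
    calc ‖1 + GammaFactor.corr θ s‖ ≤ ‖(1 : ℂ)‖ + ‖GammaFactor.corr θ s‖ := norm_add_le _ _
      _ ≤ 1 + 3 * Real.exp (-π * s.im) := by rw [norm_one]; exact add_le_add le_rfl hc
      _ ≤ 2 := by linarith
  -- `√k · k^{−σ} = k^{1/2−σ}` and `k^{e}(t/2π)^{e} = (kt/2π)^{e}`
  have hkcomb : Real.sqrt k * (k : ℝ) ^ (-s.re) = (k : ℝ) ^ (1 / 2 - s.re) := by
    rw [Real.sqrt_eq_rpow, ← Real.rpow_add hk0]
    ring_nf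
  have hmul : (k : ℝ) ^ (1 / 2 - s.re) * (s.im / (2 * π)) ^ (1 / 2 - s.re) =
      ((k : ℝ) * s.im / (2 * π)) ^ (1 / 2 - s.re) := by
    rw [← Real.mul_rpow hk0.le hbase]
    congr 1
    ring
  have hkσ : 0 ≤ (k : ℝ) ^ (-s.re) := Real.rpow_nonneg hk0.le _
  calc ‖θ (-1) * GammaFactor.tau θ * (k : ℂ) ^ (-s) * SiegelIntegral.rsChi s *
        (1 + GammaFactor.corr θ s)‖
      = ‖θ (-1)‖ * ‖GammaFactor.tau θ‖ * ‖(k : ℂ) ^ (-s)‖ * ‖SiegelIntegral.rsChi s‖ *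
          ‖1 + GammaFactor.corr θ s‖ := by
        simp only [norm_mul]
    _ ≤ 1 * Real.sqrt k * (k : ℝ) ^ (-s.re) * (2 * (s.im / (2 * π)) ^ (1 / 2 - s.re)) * 2 := by
        rw [hτ, hkpow]
        gcongr
    _ = 4 * ((Real.sqrt k * (k : ℝ) ^ (-s.re)) * (s.im / (2 * π)) ^ (1 / 2 - s.re)) := by ring
    _ = 4 * ((k : ℝ) * s.im / (2 * π)) ^ (1 / 2 - s.re) := by rw [hkcomb, hmul]

/-! ### The §2/§6 parameter ranges on `−𝓛⁹ ≤ u ≤ −1`, `|v| ≤ 𝓛²⁰` (for `D ≥ 9`) -/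

/-- Powers of `𝓛 ≥ 2` compared: `𝓛^m ≤ 𝓛^n` for `m ≤ n`, and `2 ≤ 𝓛^n` for `n ≥ 1`.
[cite: Zhang2022LandauSiegel, §2 (2.1)] -/
theorem ell_pow_le_pow {D : ℕ} (hD : 9 ≤ D) {m n : ℕ} (hmn : m ≤ n) : ell D ^ m ≤ ell D ^ n :=
  pow_le_pow_right₀ (by linarith [two_le_ell hD]) hmn

/-- For `D ≥ 9` and `n ≠ 0`: `2 ≤ 𝓛ⁿ`. [cite: Zhang2022LandauSiegel, §2 (2.1)] -/
theorem two_le_ell_pow {D : ℕ} (hD : 9 ≤ D) {n : ℕ} (hn : n ≠ 0) : 2 ≤ ell D ^ n :=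
  (two_le_ell hD).trans (le_self_pow₀ (by linarith [two_le_ell hD]) hn)

/-- **The height `t′ = t + v` on the contour** (§6 p. 32 with §2 (2.8) `t₀ = 𝓛⁵¹⁹`, `𝓛₁ = 𝓛⁴⁰⁵`):
for `s` in the range of Lemma 6.1 and `|v| ≤ 𝓛²⁰`, `𝓛⁵¹⁹ ≤ t + v ≤ 11𝓛⁵¹⁹` (`D ≥ 9`).
[cite: Zhang2022LandauSiegel, §6 Lemma 6.1 p.30] -/
theorem im_add_range {D : ℕ} (hD : 9 ≤ D) {s : ℂ} (hs : InRange61 D s) {v : ℝ}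
    (hv : |v| ≤ ell D ^ 20) : ell D ^ 519 ≤ s.im + v ∧ s.im + v ≤ 11 * ell D ^ 519 := by
  obtain ⟨_, ht⟩ := hs
  rw [t0, ell1] at ht
  obtain ⟨ht1, ht2⟩ := abs_lt.mp ht
  obtain ⟨hv1, hv2⟩ := abs_le.mp hv
  have h405 : ell D ^ 405 ≤ ell D ^ 519 := ell_pow_le_pow hD (by norm_num)
  have h20 : ell D ^ 20 ≤ ell D ^ 519 := ell_pow_le_pow hD (by norm_num)
  have h2 : (2 : ℝ) ≤ ell D ^ 519 := two_le_ell_pow hD (by norm_num)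
  have hπ3 := Real.pi_gt_three
  have hπ4 := Real.pi_lt_four
  have h519 : 0 ≤ ell D ^ 519 := by linarith
  constructor <;> nlinarith

/-- **The real part `σ′ = σ + u` on the contour**: `|σ + u| ≤ 𝓛⁹` for `|σ − 1/2| < 2α ≤ 1/4` and
`−𝓛⁹ ≤ u ≤ −1` (`D ≥ 9`). [cite: Zhang2022LandauSiegel, §6 p.32] -/
theorem abs_re_add_le {D : ℕ} (hD : 9 ≤ D) {s : ℂ} (hs : InRange61 D s) {u : ℝ}
    (hu9 : -(ell D ^ 9) ≤ u) (hu1 : u ≤ -1) : |s.re + u| ≤ ell D ^ 9 := by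
  obtain ⟨hσ, _⟩ := hs
  obtain ⟨hσ1, hσ2⟩ := abs_lt.mp hσ
  have hα := alpha_le hD
  rw [abs_le]
  constructor <;> nlinarith

/-- `38(𝓛⁹ + 1)² ≤ 𝓛⁵¹⁹` for `D ≥ 9` (the threshold of the tree's Stirling formula at `A = 𝓛⁹`).
[cite: Zhang2022LandauSiegel, §2 (2.8)] -/
theorem stirling_threshold_le {D : ℕ} (hD : 9 ≤ D) : 38 * (ell D ^ 9 + 1) ^ 2 ≤ ell D ^ 519 := by
  have hℓ := two_le_ell hD
  have h9 : (1 : ℝ) ≤ ell D ^ 9 := by linarith [two_le_ell_pow hD (n := 9) (by norm_num)]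
  have h8 : (256 : ℝ) ≤ ell D ^ 8 := by
    calc (256 : ℝ) = 2 ^ 8 := by norm_num
      _ ≤ ell D ^ 8 := by gcongr
  have h26 : ell D ^ 26 ≤ ell D ^ 519 := ell_pow_le_pow hD (by norm_num)
  have e26 : ell D ^ 26 = ell D ^ 8 * (ell D ^ 9) ^ 2 := by ring
  nlinarith

/-- **The modulus `p ∼ P`**: `P < p < (9/8)P` for `ψ (mod p) ∈ Ψ` (window `P < p < P(1 + 𝓛⁻⁶⁸)`,
`D ≥ 9`). [cite: Zhang2022LandauSiegel, §2 p.5] -/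
theorem p_range {D : ℕ} (hD : 9 ≤ D) (x : Chr D) :
    bigP D < (x.p : ℝ) ∧ (x.p : ℝ) ≤ 9 / 8 * bigP D := by
  have hm := x.mem
  rw [primeWindow, Finset.mem_filter, Finset.mem_Ioo] at hm
  have hP : 0 < bigP D := Real.exp_pos _
  have h1 : bigP D < (x.p : ℝ) := (Nat.floor_lt hP.le).mp hm.1.1
  have h2 : (x.p : ℝ) < bigP D * (1 + (ell D ^ 68)⁻¹) := Nat.lt_ceil.mp hm.1.2
  have h68 : (8 : ℝ) ≤ ell D ^ 68 := by
    have h3 : (8 : ℝ) ≤ ell D ^ 3 := by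
      calc (8 : ℝ) = 2 ^ 3 := by norm_num
        _ ≤ ell D ^ 3 := by gcongr; exact two_le_ell hD
    exact h3.trans (ell_pow_le_pow hD (by norm_num))
  have hinv : (ell D ^ 68)⁻¹ ≤ 1 / 8 := by
    rw [inv_eq_one_div]; exact one_div_le_one_div_of_le (by norm_num) h68
  refine ⟨h1, h2.le.trans ?_⟩
  nlinarith

/-- `log(2Pt₀) ≤ 4𝓛⁹` (`P = e^{𝓛⁹}`, `t₀ = 𝓛⁵¹⁹`, `log 𝓛 ≤ 𝓛`, `519𝓛 ≤ 2.1𝓛⁹`, `D ≥ 9`).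
[cite: Zhang2022LandauSiegel, §2 (2.6), (2.8)] -/
theorem log_two_bigP_t0_le {D : ℕ} (hD : 9 ≤ D) :
    Real.log (2 * bigP D * t0 D) ≤ 4 * ell D ^ 9 := by
  have hℓ := two_le_ell hD
  have hℓ0 : 0 < ell D := by linarith
  have hP : 0 < bigP D := Real.exp_pos _
  have ht0 : 0 < t0 D := pow_pos hℓ0 519
  rw [Real.log_mul (by positivity) ht0.ne', Real.log_mul (by norm_num) hP.ne', bigP, Real.log_exp,
    t0, Real.log_pow]
  have hlog2 : Real.log 2 ≤ 1 := by
    have := Real.log_two_lt_d9; linarith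
  have hlogℓ : Real.log (ell D) ≤ ell D := by
    have := Real.log_le_sub_one_of_pos hℓ0; linarith
  have h8 : (256 : ℝ) ≤ ell D ^ 8 := by
    calc (256 : ℝ) = 2 ^ 8 := by norm_num
      _ ≤ ell D ^ 8 := by gcongr
  have e9 : ell D ^ 9 = ell D ^ 8 * ell D := by ring
  push_cast
  nlinarith

/-- **`Z22:§6.u013` DISCHARGED** (§6 p. 32, tex L1747): for `ψ (mod p) ∈ Ψ`, `s` in the range of
Lemma 6.1, `−𝓛⁹ ≤ u ≤ −1`, `|v| ≤ 𝓛²⁰`, `w = u + iv`: `‖Z(s+w,ψ)P₄^w‖ ≤ C·(2T²)^{−u}` with an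
absolute `C` (`= 4e^{8π}`), for all `D ≥ 9` — the typed claim `Section6Statements.Step6u013` HOLDS.
Route (replacing the dangling "(4.)"): `‖Z(σ′+it′,ψ)‖ ≤ 4(pt′/2π)^{1/2−σ′}` (`norm_Zfac_le`, Stirling
with `A = 𝓛⁹`, `t′ = t + v ≥ 𝓛⁵¹⁹ ≥ 38(A+1)²`), `|P₄^w| = P₄^u`, so the product is
`4(pt′/2π)^{1/2−σ}·((pt′/2π)/P₄)^{−u}` with `(pt′/2π)/P₄ = pt′T²/(2πPt₀) ≤ 2T²` (`p ≤ 9P/8`,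
`t′ ≤ 11t₀`) and `(pt′/2π)^{1/2−σ} ≤ (2Pt₀)^{2α} ≤ e^{8π}`. The Assumption (A) binder is not used.
[cite: Zhang2022LandauSiegel, §6 p.32] -/
theorem step6u013_holds : Step6u013 := by
  refine ⟨4 * Real.exp (8 * π), 9, fun D _ χ hD _ _ _ x s hs u v hu9 hu1 hv => ?_⟩
  -- parameters
  have hℓ := two_le_ell hD
  have hℓ0 : 0 < ell D := by linarith
  have hα := alpha_le hD
  have hαeq := Section2.alpha_eq_pi_div_ell9 D
  have hP : 0 < bigP D := Real.exp_pos _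
  have hT : 0 < bigT D := Real.exp_pos _
  have ht0 : 0 < t0 D := pow_pos hℓ0 519
  have hP4 : 0 < P4 D := by rw [P4]; positivity
  obtain ⟨htlo, hthi⟩ := im_add_range hD hs hv
  have hσu := abs_re_add_le hD hs hu9 hu1
  obtain ⟨hp1, hp2⟩ := p_range hD x
  have hp0 : (0 : ℝ) < x.p := hP.trans hp1
  have h519 : (2 : ℝ) ≤ ell D ^ 519 := two_le_ell_pow hD (by norm_num)
  obtain ⟨hσ, _⟩ := hs
  obtain ⟨hσ1, hσ2⟩ := abs_lt.mp hσ
  -- the point `s′ = s + w`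
  set s' : ℂ := s + ((u : ℂ) + (v : ℂ) * I) with hs'
  have hre : s'.re = s.re + u := by simp [hs']
  have him : s'.im = s.im + v := by simp [hs']
  have ht1 : 1 ≤ s'.im := by rw [him]; linarith
  have hA : (1 : ℝ) ≤ ell D ^ 9 := by linarith [two_le_ell_pow hD (n := 9) (by norm_num)]
  have hσA : |s'.re| ≤ ell D ^ 9 := by rw [hre]; exact hσu
  have htA : 38 * (ell D ^ 9 + 1) ^ 2 ≤ s'.im := by
    rw [him]; exact (stirling_threshold_le hD).trans htlo
  haveI : NeZero x.p := ⟨x.prime.ne_zero⟩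
  have hZ := norm_Zfac_le x.prim hA hσA ht1 htA
  rw [hre, him] at hZ
  -- `|P₄^w| = P₄^u`
  have hP4n : ‖((P4 D : ℝ) : ℂ) ^ ((u : ℂ) + (v : ℂ) * I)‖ = P4 D ^ u := by
    rw [Complex.norm_cpow_eq_rpow_re_of_pos hP4]
    simp
  -- the base `B = pt′/2π`
  set B : ℝ := (x.p : ℝ) * (s.im + v) / (2 * π) with hB
  have ht'0 : 0 < s.im + v := by linarith
  have hB0 : 0 < B := div_pos (mul_pos hp0 ht'0) (by positivity)
  have hBig : 2 * π ≤ bigP D := by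
    have h9 : (512 : ℝ) ≤ ell D ^ 9 := by
      calc (512 : ℝ) = 2 ^ 9 := by norm_num
        _ ≤ ell D ^ 9 := by gcongr
    have h1 : Real.exp 512 ≤ bigP D := by rw [bigP]; exact Real.exp_le_exp.mpr h9
    have h2 : (512 : ℝ) + 1 ≤ Real.exp 512 := Real.add_one_le_exp _
    nlinarith [Real.pi_lt_four]
  have hB1 : 1 ≤ B := by
    rw [hB, le_div_iff₀ (by positivity)]
    nlinarith
  -- `B ≤ 2Pt₀` and `B/P₄ ≤ 2T²`
  have hBle : B ≤ 2 * bigP D * t0 D := by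
    rw [hB, div_le_iff₀ (by positivity), t0]
    have hπ := Real.pi_gt_d2
    have hPl : 0 ≤ bigP D * ell D ^ 519 := by positivity
    calc (x.p : ℝ) * (s.im + v) ≤ 9 / 8 * bigP D * (11 * ell D ^ 519) :=
          mul_le_mul hp2 hthi ht'0.le (by positivity)
      _ = 99 / 8 * (bigP D * ell D ^ 519) := by ring
      _ ≤ 4 * π * (bigP D * ell D ^ 519) := by
          apply mul_le_mul_of_nonneg_right _ hPl; linarith
      _ = 2 * bigP D * ell D ^ 519 * (2 * π) := by ring
  have hP4eq : 2 * bigT D ^ 2 * P4 D = 2 * bigP D * t0 D := by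
    rw [P4]; field_simp
  have hBP4 : B / P4 D ≤ 2 * bigT D ^ 2 := by
    rw [div_le_iff₀ hP4, hP4eq]; exact hBle
  -- `log B ≤ 4𝓛⁹`, so `B^{1/2−σ} ≤ B^{2α} ≤ e^{8π}`
  have hlogB : Real.log B ≤ 4 * ell D ^ 9 :=
    (Real.log_le_log hB0 hBle).trans (log_two_bigP_t0_le hD)
  have hexp1 : B ^ (1 / 2 - s.re) ≤ Real.exp (8 * π) := by
    have h1 : B ^ (1 / 2 - s.re) ≤ B ^ (2 * alpha D) :=
      Real.rpow_le_rpow_of_exponent_le hB1 (by linarith)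
    have h2 : B ^ (2 * alpha D) = Real.exp (Real.log B * (2 * alpha D)) :=
      Real.rpow_def_of_pos hB0 _
    have hα0 : 0 ≤ alpha D := by rw [hαeq]; positivity
    have h3 : Real.log B * (2 * alpha D) ≤ 8 * π := by
      calc Real.log B * (2 * alpha D) ≤ 4 * ell D ^ 9 * (2 * alpha D) :=
            mul_le_mul_of_nonneg_right hlogB (by positivity)
        _ = 8 * π := by rw [hαeq]; field_simp; ring
    rw [h2] at h1
    exact h1.trans (Real.exp_le_exp.mpr h3)
  -- `(B/P₄)^{−u} ≤ (2T²)^{−u}`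
  have hu0 : 0 ≤ -u := by linarith
  have hexp2 : (B / P4 D) ^ (-u) ≤ (2 * bigT D ^ 2) ^ (-u) :=
    Real.rpow_le_rpow (div_nonneg hB0.le hP4.le) hBP4 hu0
  -- the algebra `B^{1/2−σ−u}·P₄^u = B^{1/2−σ}·(B/P₄)^{−u}`
  have halg : B ^ (1 / 2 - (s.re + u)) * P4 D ^ u = B ^ (1 / 2 - s.re) * (B / P4 D) ^ (-u) := by
    rw [show (1 / 2 - (s.re + u)) = (1 / 2 - s.re) + (-u) by ring, Real.rpow_add hB0,
      Real.div_rpow hB0.le hP4.le, show P4 D ^ u = P4 D ^ (-(-u)) by rw [neg_neg],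
      Real.rpow_neg hP4.le (-u)]
    ring
  have hBre : ((x.p : ℝ) * (s.im + v) / (2 * π)) = B := rfl
  have hpos1 : 0 ≤ B ^ (1 / 2 - s.re) := Real.rpow_nonneg hB0.le _
  have hpos2 : 0 ≤ (B / P4 D) ^ (-u) := Real.rpow_nonneg (div_nonneg hB0.le hP4.le) _
  calc ‖GammaFactor.Zfac x.ψ (s + ((u : ℂ) + (v : ℂ) * I)) * ((P4 D : ℝ) : ℂ) ^ ((u : ℂ) + (v : ℂ) * I)‖
      = ‖GammaFactor.Zfac x.ψ s'‖ * P4 D ^ u := by rw [norm_mul, hP4n]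
    _ ≤ 4 * B ^ (1 / 2 - (s.re + u)) * P4 D ^ u :=
        mul_le_mul_of_nonneg_right hZ (Real.rpow_nonneg hP4.le _)
    _ = 4 * (B ^ (1 / 2 - s.re) * (B / P4 D) ^ (-u)) := by rw [mul_assoc, halg]
    _ ≤ 4 * (Real.exp (8 * π) * (2 * bigT D ^ 2) ^ (-u)) := by
        gcongr
    _ = 4 * Real.exp (8 * π) * (2 * bigT D ^ 2) ^ (-u) := by ring

end Literature.NumberTheory.LFunctions.Zhang2022.Section6TailBounds

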